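import Summits.QuantumFields.QCD.Theses.SpectralDefectExtinction
import Summits.QuantumFields.QCD.Theorems.SpectralDefectExtinctionExtinctionBuildsQCDCleanRefStubCombesThomasWilson
import Literature.Probability.LatticeModels.ThermodynamicLimit
import Literature.MathematicalPhysics.QuantumFieldTheory.QCD
import Literature.MathematicalPhysics.QuantumLattice.WilsonDiracRangeOne

/-!
# Combes–Thomas decay inside a coercive wall block (sub-goal `wallBlock_inv_decay` of crux stmt-QuantumFields-8967)

Deterministic lemma (CT) of the modular cell–wall template (crux idea `Cruxes/TipPricing/Ideas/modular-cell-wall-template.md`,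
lead c2; serves stub `stub_spreadOfCells` of line `hermitian-flow-coarea` r3 for crux `TipPricing`): the principal block of the
Wilson–Dirac operator `D_W(U, m, 1)` over the quark indices of a set `W` of sites inside an embedded box `c + {−R..R}⁴`
(`2R+1 < n`, so box coordinates are unique and no hopping wraps around the torus inside the box) is range-one for the
box-coordinate sup-distance with off-site absolute row/column sums `≤ 96`; hence, if it has a norm gap `g ∈ (0,1]`
(e.g. from flux-region coercivity, `fluxRegion_hopping_form_le`), the tree's abstract `coercive_combes_thomas` gives
invertibility and `|(block⁻¹)_{pq}| ≤ (2/g)·exp(−(g/400)·dist_box(p,q))`.  Supports stmt-QuantumFields-8967 (helper; closes no item).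

Proof.  (1) Box coordinates: for `2R+1 < n` the map `y ↦ Torus.proj n (c + y)` is injective on `box 4 R`
(`wallDecay_boxCoord_unique`), and a nearest-neighbour hop on the torus between two images of box points is a unit
hop of the box coordinates (`wallDecay_boxCoord_shift`); so the sup-distance of box coordinates is a well-defined
pseudo-metric on the wall indices.  (2) Geometry of `D_W` (the public range-one facts of
`Literature/MathematicalPhysics/QuantumLattice/WilsonDiracRangeOne.lean`): a non-zero entry joins equal or
nearest-neighbour sites (`wallDecay_wilsonDirac_hop`), hence RANGE ONE in the box distance, and the off-site absolute
row/column sums of the BLOCK are bounded by the corresponding full-torus off-site sums `≤ 32 · 3 = 96`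
(`wallDecay_block_rowSum_le`, `wallDecay_block_colSum_le`).  (3) With `θ = g/400 ≤ 1`,
`96 (e^θ − 1) ≤ 192 θ < g/2` (`Real.abs_exp_sub_one_le`), and `coercive_combes_thomas` applies to the block with the
given norm gap.

References: Combes–Thomas, Comm. Math. Phys. 34 (1973) 251; Aizenman–Warzel, GSM 168, §10.3.
-/

noncomputable section

namespace Summit.QuantumFields.QCD.Cruxes.TipPricing.ModularTemplate

open Matrix
open Literature.MathematicalPhysics.QuantumLattice Literature.MathematicalPhysics.QuantumFieldTheory
  Literature.Probability.LatticeModels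
open scoped BigOperators Classical

open Summit.QuantumFields.QCD.Cruxes.ExtinctionBuildsQCD.CleanReferenceDeterminantLocality (coercive_combes_thomas)

/-! ### (1) Box coordinates on the torus -/

-- adapted from Theorems/SpectralDefectExtinctionWindowExtinctionSpreadTorusBoxes.lean (`spread_proj_add_injective`)

/-- `Torus.proj` of a lattice point shifted by a unit vector is the torus shift of its image. -/
theorem wallDecay_proj_add_single (n : ℕ) (x : Fin 4 → ℤ) (μ : Fin 4) :
    Torus.proj n (x + Pi.single μ 1) = Site.shift (Torus.proj n x) μ := by
  funext k
  simp only [Literature.MathematicalPhysics.QuantumFieldTheory.Site.shift, Torus.proj_apply, Pi.add_apply,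
    Int.cast_add]
  by_cases h : k = μ
  · subst h; simp
  · simp [h]

/-- Lattice points `c + y`, `c + y'` with the same image on the torus of side `n` and `|y_k − y'_k| < n` for all `k`
have `y = y'`. -/
theorem wallDecay_eq_of_proj_eq (n : ℕ) (c y y' : Fin 4 → ℤ) (hlt : ∀ k, |y k - y' k| < n)
    (h : Torus.proj n (c + y) = Torus.proj n (c + y')) : y = y' := by
  funext k
  have hk : (((c + y) k : ℤ) : ZMod n) = (((c + y') k : ℤ) : ZMod n) := by
    have := congrFun h k
    simpa only [Torus.proj_apply] using this
  have hdvd : (n : ℤ) ∣ y k - y' k := by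
    have := (ZMod.intCast_eq_intCast_iff_dvd_sub _ _ n).1 hk.symm
    simpa only [Pi.add_apply, add_sub_add_left_eq_sub] using this
  have := Int.eq_zero_of_abs_lt_dvd hdvd (hlt k)
  linarith

/-- **Box coordinates are unique**: for `2R+1 < n` the map `y ↦ Torus.proj n (c + y)` is injective on `box 4 R`. -/
theorem wallDecay_boxCoord_unique {n R : ℕ} (hR : 2 * R + 1 < n) (c : Fin 4 → ℤ) {y y' : Fin 4 → ℤ}
    (hy : y ∈ box 4 R) (hy' : y' ∈ box 4 R) (h : Torus.proj n (c + y) = Torus.proj n (c + y')) : y = y' := by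
  refine wallDecay_eq_of_proj_eq n c y y' (fun k => ?_) h
  have h1 := (mem_box.1 hy) k
  have h2 := (mem_box.1 hy') k
  exact abs_lt.2 ⟨by omega, by omega⟩

/-- **Hops do not wrap around inside the box**: if the image of `c + y'` is the torus shift in direction `μ` of the
image of `c + y` (`y, y' ∈ box 4 R`, `2R+1 < n`), then `y' = y + e_μ`. -/
theorem wallDecay_boxCoord_shift {n R : ℕ} (hR : 2 * R + 1 < n) (c : Fin 4 → ℤ) {y y' : Fin 4 → ℤ}
    (hy : y ∈ box 4 R) (hy' : y' ∈ box 4 R) (μ : Fin 4)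
    (h : Torus.proj n (c + y') = Site.shift (Torus.proj n (c + y)) μ) : y' = y + Pi.single μ 1 := by
  rw [← wallDecay_proj_add_single, add_assoc] at h
  refine wallDecay_eq_of_proj_eq n c y' (y + Pi.single μ 1) (fun k => ?_) h
  have h1 := (mem_box.1 hy) k
  have h2 := (mem_box.1 hy') k
  rw [Pi.add_apply]
  by_cases hk : k = μ
  · subst hk
    rw [Pi.single_eq_same]
    exact abs_lt.2 ⟨by omega, by omega⟩
  · rw [Pi.single_eq_of_ne hk]
    exact abs_lt.2 ⟨by omega, by omega⟩

/-- The box sup-distance vanishes on the diagonal. -/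
theorem wallDecay_supDist_self (x : Fin 4 → ℤ) : (Finset.univ.sup fun i => (x i - x i).natAbs) = 0 :=
  le_antisymm (Finset.sup_le fun i _ => by simp) (Nat.zero_le _)

/-- The box sup-distance is symmetric. -/
theorem wallDecay_supDist_comm (x y : Fin 4 → ℤ) :
    (Finset.univ.sup fun i => (x i - y i).natAbs) = Finset.univ.sup fun i => (y i - x i).natAbs := by
  congr 1
  funext i
  rw [← Int.natAbs_neg, neg_sub]

/-- The box sup-distance satisfies the triangle inequality. -/
theorem wallDecay_supDist_triangle (x y z : Fin 4 → ℤ) :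
    (Finset.univ.sup fun i => (x i - z i).natAbs) ≤
      (Finset.univ.sup fun i => (x i - y i).natAbs) + Finset.univ.sup fun i => (y i - z i).natAbs := by
  refine Finset.sup_le fun i _ => ?_
  calc (x i - z i).natAbs = ((x i - y i) + (y i - z i)).natAbs := by rw [sub_add_sub_cancel]
    _ ≤ (x i - y i).natAbs + (y i - z i).natAbs := Int.natAbs_add_le _ _
    _ ≤ _ := add_le_add (Finset.le_sup (f := fun i => (x i - y i).natAbs) (Finset.mem_univ i))
        (Finset.le_sup (f := fun i => (y i - z i).natAbs) (Finset.mem_univ i))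

/-- A unit hop has box sup-distance at most `1`. -/
theorem wallDecay_supDist_add_single_le (x : Fin 4 → ℤ) (μ : Fin 4) :
    (Finset.univ.sup fun i => (x i - (x + Pi.single μ (1 : ℤ) : Fin 4 → ℤ) i).natAbs) ≤ 1 := by
  refine Finset.sup_le fun i _ => ?_
  rw [Pi.add_apply]
  by_cases h : i = μ
  · subst h
    rw [Pi.single_eq_same]
    omega
  · rw [Pi.single_eq_of_ne h]
    omega

/-! ### (2) The geometry of the Wilson–Dirac matrix and of its principal blocks -/

/-- **Nearest-neighbour structure**: a non-zero entry `D_{pq}` joins equal sites or sites related by a unit hop in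
some direction (`Literature…WilsonDiracRangeOne.wilsonDirac_apply_eq_zero_of_not_adj`). -/
theorem wallDecay_wilsonDirac_hop {n : ℕ} (U : GaugeConfig 4 n SU3) (m : ℝ) (p q : TorusSite 4 n × Fin 3 × Fin 4)
    (h : wilsonDirac (fundamentalRep (Fin 3)) U m 1 p q ≠ 0) :
    p.1 = q.1 ∨ ∃ μ : Fin 4, q.1 = Site.shift p.1 μ ∨ p.1 = Site.shift q.1 μ := by
  by_contra hc
  have hne : p.1 ≠ q.1 := fun e => hc (Or.inl e)
  have hpq : p ≠ q := fun e => hne (by rw [e])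
  exact h (wilsonDirac_apply_eq_zero_of_not_adj (fundamentalRep (Fin 3)) (fun g => fundamentalRep_mem_unitaryGroup g)
    U m hpq (fun μ e => hc (Or.inr ⟨μ, Or.inl e⟩)) (fun μ e => hc (Or.inr ⟨μ, Or.inr e⟩)))

variable {n : ℕ} [NeZero n]

/-- **Row sums of a principal block**: for a wall index `p`, the absolute row sum of the block of `D_W` over the wall
indices at other SITES is at most `96` (bounded by the full-torus off-site row sum,
`Literature…WilsonDiracRangeOne.wilsonDirac_offsite_rowSum_le`). -/
theorem wallDecay_block_rowSum_le (U : GaugeConfig 4 n SU3) (m : ℝ) (W : Set (TorusSite 4 n))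
    (p : {p : TorusSite 4 n × Fin 3 × Fin 4 // p.1 ∈ W}) :
    ∑ q ∈ Finset.univ.filter (fun q : {p : TorusSite 4 n × Fin 3 × Fin 4 // p.1 ∈ W} => p.1.1 ≠ q.1.1),
      ‖wilsonDirac (fundamentalRep (Fin 3)) U m 1 p.1 q.1‖ ≤ 96 := by
  calc _ = ∑ q ∈ (Finset.univ.filter (fun q : {p : TorusSite 4 n × Fin 3 × Fin 4 // p.1 ∈ W} => p.1.1 ≠ q.1.1)).map
          (Function.Embedding.subtype _), ‖wilsonDirac (fundamentalRep (Fin 3)) U m 1 p.1 q‖ :=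
        (Finset.sum_map _ _ _).symm
    _ ≤ ∑ q ∈ Finset.univ.filter (fun q : TorusSite 4 n × Fin 3 × Fin 4 => p.1.1 ≠ q.1),
          ‖wilsonDirac (fundamentalRep (Fin 3)) U m 1 p.1 q‖ := by
        refine Finset.sum_le_sum_of_subset_of_nonneg (fun q hq => ?_) fun _ _ _ => norm_nonneg _
        simp only [Finset.mem_map, Finset.mem_filter, Finset.mem_univ, true_and,
          Function.Embedding.coe_subtype] at hq ⊢
        obtain ⟨q', hq', rfl⟩ := hq
        exact hq'
    _ ≤ 32 * ((3 : ℕ) : ℝ) :=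
        wilsonDirac_offsite_rowSum_le (fundamentalRep (Fin 3)) (fun g => fundamentalRep_mem_unitaryGroup g) U m p.1 _
          fun _ h => h
    _ = 96 := by norm_num

/-- **Column sums of a principal block**: for a wall index `q`, the absolute column sum of the block of `D_W` over the
wall indices at other SITES is at most `96` (`Literature…WilsonDiracRangeOne.wilsonDirac_offsite_colSum_le`). -/
theorem wallDecay_block_colSum_le (U : GaugeConfig 4 n SU3) (m : ℝ) (W : Set (TorusSite 4 n))
    (q : {p : TorusSite 4 n × Fin 3 × Fin 4 // p.1 ∈ W}) :
    ∑ p ∈ Finset.univ.filter (fun p : {p : TorusSite 4 n × Fin 3 × Fin 4 // p.1 ∈ W} => p.1.1 ≠ q.1.1),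
      ‖wilsonDirac (fundamentalRep (Fin 3)) U m 1 p.1 q.1‖ ≤ 96 := by
  calc _ = ∑ p ∈ (Finset.univ.filter (fun p : {p : TorusSite 4 n × Fin 3 × Fin 4 // p.1 ∈ W} => p.1.1 ≠ q.1.1)).map
          (Function.Embedding.subtype _), ‖wilsonDirac (fundamentalRep (Fin 3)) U m 1 p q.1‖ :=
        (Finset.sum_map _ _ _).symm
    _ ≤ ∑ p ∈ Finset.univ.filter (fun p : TorusSite 4 n × Fin 3 × Fin 4 => p.1 ≠ q.1.1),
          ‖wilsonDirac (fundamentalRep (Fin 3)) U m 1 p q.1‖ := by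
        refine Finset.sum_le_sum_of_subset_of_nonneg (fun p hp => ?_) fun _ _ _ => norm_nonneg _
        simp only [Finset.mem_map, Finset.mem_filter, Finset.mem_univ, true_and,
          Function.Embedding.coe_subtype] at hp ⊢
        obtain ⟨p', hp', rfl⟩ := hp
        exact hp'
    _ ≤ 32 * ((3 : ℕ) : ℝ) :=
        wilsonDirac_offsite_colSum_le (fundamentalRep (Fin 3)) (fun g => fundamentalRep_mem_unitaryGroup g) U m q.1 _
          fun _ h => h
    _ = 96 := by norm_num

/-! ### (3) The stub -/

/-- **Combes–Thomas decay of the inverse of a coercive wall block of the Wilson–Dirac operator** (box-coordinate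
sup-distance; constants `2/g` and rate `g/400` as in the tree's `coercive_combes_thomas` application to `D_W`). [folklore] -/
theorem wallBlock_inv_decay {n : ℕ} [NeZero n] (U : GaugeConfig 4 n SU3) (m : ℝ) (c : Fin 4 → ℤ) (R : ℕ)
    (hR : 2 * R + 1 < n) (W : Set (TorusSite 4 n))
    (hW : ∀ x ∈ W, ∃ y : Fin 4 → ℤ, y ∈ box 4 R ∧ Torus.proj n (c + y) = x) {g : ℝ} (hg : 0 < g) (hg1 : g ≤ 1)
    (hgap : ∀ v : {p : TorusSite 4 n × Fin 3 × Fin 4 // p.1 ∈ W} → ℂ,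
      g ^ 2 * ∑ i, ‖v i‖ ^ 2 ≤
        ∑ i, ‖(((wilsonDirac (fundamentalRep (Fin 3)) U m 1).submatrix
          (Subtype.val : {p : TorusSite 4 n × Fin 3 × Fin 4 // p.1 ∈ W} → _) Subtype.val) *ᵥ v) i‖ ^ 2) :
    IsUnit ((wilsonDirac (fundamentalRep (Fin 3)) U m 1).submatrix
        (Subtype.val : {p : TorusSite 4 n × Fin 3 × Fin 4 // p.1 ∈ W} → _) Subtype.val).det ∧
      ∀ (p q : {p : TorusSite 4 n × Fin 3 × Fin 4 // p.1 ∈ W}) (yp yq : Fin 4 → ℤ), yp ∈ box 4 R → yq ∈ box 4 R →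
        Torus.proj n (c + yp) = p.1.1 → Torus.proj n (c + yq) = q.1.1 →
        ‖((wilsonDirac (fundamentalRep (Fin 3)) U m 1).submatrix
            (Subtype.val : {p : TorusSite 4 n × Fin 3 × Fin 4 // p.1 ∈ W} → _) Subtype.val)⁻¹ p q‖ ≤
          2 / g * Real.exp (-(g / 400 * ((Finset.univ.sup fun i : Fin 4 => (yp i - yq i).natAbs : ℕ) : ℝ))) := by
  -- (1) box coordinates `Y p ∈ box 4 R` of the wall indices, `Torus.proj n (c + Y p) = p.1.1`, unique by `hR`
  choose Y hYbox hYproj using fun p : {p : TorusSite 4 n × Fin 3 × Fin 4 // p.1 ∈ W} => hW p.1.1 p.2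
  have hYeq : ∀ p q : {p : TorusSite 4 n × Fin 3 × Fin 4 // p.1 ∈ W}, p.1.1 = q.1.1 → Y p = Y q :=
    fun p q h => wallDecay_boxCoord_unique hR c (hYbox p) (hYbox q) (by rw [hYproj p, hYproj q]; exact h)
  -- the box sup-distance of the wall indices: a pseudo-metric
  set dist : {p : TorusSite 4 n × Fin 3 × Fin 4 // p.1 ∈ W} → {p : TorusSite 4 n × Fin 3 × Fin 4 // p.1 ∈ W} → ℕ :=
    fun p q => Finset.univ.sup fun i : Fin 4 => (Y p i - Y q i).natAbs with hdist
  have hd0 : ∀ p, dist p p = 0 := fun p => wallDecay_supDist_self (Y p)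
  have hds : ∀ p q, dist p q = dist q p := fun p q => wallDecay_supDist_comm (Y p) (Y q)
  have hdt : ∀ p q r, dist p r ≤ dist p q + dist q r := fun p q r => wallDecay_supDist_triangle (Y p) (Y q) (Y r)
  have hne : ∀ p q, dist p q ≠ 0 → p.1.1 ≠ q.1.1 := by
    intro p q h hpq
    apply h
    show (Finset.univ.sup fun i : Fin 4 => (Y p i - Y q i).natAbs) = 0
    rw [hYeq p q hpq]
    exact wallDecay_supDist_self (Y q)
  -- (2) range one and off-site row/column sums `≤ 96` of the block
  have hrange : ∀ p q, (wilsonDirac (fundamentalRep (Fin 3)) U m 1).submatrix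
      (Subtype.val : {p : TorusSite 4 n × Fin 3 × Fin 4 // p.1 ∈ W} → _) Subtype.val p q ≠ 0 → dist p q ≤ 1 := by
    intro p q hpq
    rw [Matrix.submatrix_apply] at hpq
    rcases wallDecay_wilsonDirac_hop U m p.1 q.1 hpq with h | ⟨μ, h | h⟩
    · have h0 : dist p q = 0 := by
        show (Finset.univ.sup fun i : Fin 4 => (Y p i - Y q i).natAbs) = 0
        rw [hYeq p q h]
        exact wallDecay_supDist_self (Y q)
      rw [h0]
      exact Nat.zero_le 1
    · have hY : Y q = Y p + Pi.single μ 1 :=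
        wallDecay_boxCoord_shift hR c (hYbox p) (hYbox q) μ (by rw [hYproj p, hYproj q]; exact h)
      show (Finset.univ.sup fun i : Fin 4 => (Y p i - Y q i).natAbs) ≤ 1
      rw [hY]
      exact wallDecay_supDist_add_single_le (Y p) μ
    · have hY : Y p = Y q + Pi.single μ 1 :=
        wallDecay_boxCoord_shift hR c (hYbox q) (hYbox p) μ (by rw [hYproj p, hYproj q]; exact h)
      rw [hds]
      show (Finset.univ.sup fun i : Fin 4 => (Y q i - Y p i).natAbs) ≤ 1
      rw [hY]
      exact wallDecay_supDist_add_single_le (Y q) μ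
  have hrow : ∀ p, ∑ q ∈ Finset.univ.filter (fun q => dist p q ≠ 0),
      ‖(wilsonDirac (fundamentalRep (Fin 3)) U m 1).submatrix
        (Subtype.val : {p : TorusSite 4 n × Fin 3 × Fin 4 // p.1 ∈ W} → _) Subtype.val p q‖ ≤ 96 := by
    intro p
    simp only [Matrix.submatrix_apply]
    calc _ ≤ ∑ q ∈ Finset.univ.filter (fun q : {p : TorusSite 4 n × Fin 3 × Fin 4 // p.1 ∈ W} => p.1.1 ≠ q.1.1),
          ‖wilsonDirac (fundamentalRep (Fin 3)) U m 1 p.1 q.1‖ := by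
          refine Finset.sum_le_sum_of_subset_of_nonneg (fun q hq => ?_) fun _ _ _ => norm_nonneg _
          simp only [Finset.mem_filter, Finset.mem_univ, true_and] at hq ⊢
          exact hne p q hq
      _ ≤ 96 := wallDecay_block_rowSum_le U m W p
  have hcol : ∀ q, ∑ p ∈ Finset.univ.filter (fun p => dist p q ≠ 0),
      ‖(wilsonDirac (fundamentalRep (Fin 3)) U m 1).submatrix
        (Subtype.val : {p : TorusSite 4 n × Fin 3 × Fin 4 // p.1 ∈ W} → _) Subtype.val p q‖ ≤ 96 := by
    intro q
    simp only [Matrix.submatrix_apply]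
    calc _ ≤ ∑ p ∈ Finset.univ.filter (fun p : {p : TorusSite 4 n × Fin 3 × Fin 4 // p.1 ∈ W} => p.1.1 ≠ q.1.1),
          ‖wilsonDirac (fundamentalRep (Fin 3)) U m 1 p.1 q.1‖ := by
          refine Finset.sum_le_sum_of_subset_of_nonneg (fun p hp => ?_) fun _ _ _ => norm_nonneg _
          simp only [Finset.mem_filter, Finset.mem_univ, true_and] at hp ⊢
          exact hne p q hp
      _ ≤ 96 := wallDecay_block_colSum_le U m W q
  -- (3) the rate `θ = g / 400`, so that `η = 96 (e^θ − 1) ≤ g / 2`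
  set θ : ℝ := g / 400 with hθ
  have hθ0 : 0 ≤ θ := by positivity
  have hθ1 : |θ| ≤ 1 := by rw [abs_of_nonneg hθ0, hθ]; linarith
  have hη : 96 * (Real.exp θ - 1) ≤ g / 2 := by
    have h1 := Real.abs_exp_sub_one_le hθ1
    rw [abs_of_nonneg hθ0, abs_of_nonneg (by linarith [Real.add_one_le_exp θ])] at h1
    rw [hθ] at h1 ⊢
    linarith
  -- the abstract coercive Combes–Thomas bound on the wall block
  obtain ⟨hdet, hB⟩ := coercive_combes_thomas dist hd0 hds hdt _ hrange 96 hrow hcol g θ hg hθ0 hgap hη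
  refine ⟨hdet, fun p q yp yq hyp hyq hp hq => ?_⟩
  have h1 : yp = Y p := wallDecay_boxCoord_unique hR c hyp (hYbox p) (by rw [hp, hYproj p])
  have h2 : yq = Y q := wallDecay_boxCoord_unique hR c hyq (hYbox q) (by rw [hq, hYproj q])
  subst h1 h2
  exact hB p q

end Summit.QuantumFields.QCD.Cruxes.TipPricing.ModularTemplate

end
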